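import Literature.NumberTheory.Sieve.SmoothArcClassesMajorant
import Literature.NumberTheory.Sieve.SmoothArcClassesCRTLemmas
import Mathlib.Data.Finset.NatDivisors
import HarnessLib

/-!
# Class-restricted local factors: CRT factorisation, coprime moduli, bounds

Topic `Literature/NumberTheory/Sieve`; a PROVED algebraic tool file continuing `SmoothArcClasses` and
`SmoothArcClassesMajorant` ([Harper2016, §2.2, §5], [MontgomeryVaughanActa1975, §5–6]). Notation:
`L = lcm(k, m)`, `C_g(h) = classGcdSum m r k h g = ∑_{t mod L, t ≡ r (m), (t,L) = g} e(ht/k)`,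
`classLocalFactor α m r k h = ∑_{g ∣ L} C_g(h) g^{−α} ∏_{p ∣ L/g}(1 − p^{−α})/φ(L/g)`,
`classLocalHc α m r k h = ∑_{g ∣ L} |C_g(h)| g^{−α} τ(L/g)/φ(L/g)`, `c_q(h)` = `ramanujanSum q h`.

* **CRT** (`classGcdSum_mul_of_coprime`, `classLocalFactor_mul_of_coprime`, `classLocalHc_mul_of_coprime`):
  for `k_i, m_i ≥ 1`, `(k₁m₁, k₂m₂) = 1`, `u₁k₂ ≡ 1 (k₁)`, `u₂k₁ ≡ 1 (k₂)` (`exists_crt_units`):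
  `classLocalFactor α (m₁m₂) r (k₁k₂) h = classLocalFactor α m₁ r k₁ (hu₁) · classLocalFactor α m₂ r k₂ (hu₂)`,
  the same for `classLocalHc`, and `C_{g₁g₂} = C_{g₁}(hu₁) C_{g₂}(hu₂)` for `g_i ∣ L_i`
  (`t mod L₁L₂ ↔ (t mod L₁, t mod L₂)`, `e(ht/(k₁k₂)) = e(hu₁t/k₁) e(hu₂t/k₂)`);
* **coprime modulus** (`(k, m) = 1`, `(r, m) = 1`, `k, m ≥ 1`): `classGcdSum_of_coprime`:
  `C_g(h) = c_{k/g}(h)` for `g ∣ k` (else `0`) — the class only fixes the unit coordinate mod `m`;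
  `classLocalFactor_of_coprime`: `classLocalFactor = [∏_{p∣m}(1 − p^{−α})/φ(m)] ∑_{g ∣ k} c_{k/g}(h) g^{−α} ∏_{p ∣ k/g}(1 − p^{−α})/φ(k/g)`,
  `= [∏_{p∣m}(1 − p^{−α})/φ(m)] G_α(k)` when also `(h, k) = 1` (`classLocalFactor_of_coprime_of_coprime`);
  `classLocalHc_of_coprime`: `classLocalHc = τ(m)/φ(m) ∑_{g ∣ k} |c_{k/g}(h)| g^{−α} τ(k/g)/φ(k/g)`,
  `≤ τ(m)τ(k)/φ(m) · H_α(k)` when `(h, k) = 1` (`classLocalHc_le_of_coprime`); `classGcdSum_one` (`m = 1`);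
* **bounds**: `norm_classGcdSum_le_card` (trivial); with `norm_ramanujanSum_le_sum_divisors`
  (`|c_q(h)| ≤ σ((q,|h|))`, in `SmoothArcClassesCRTLemmas`) these give the absolute convergence of the
  singular series built from `classLocalFactor`.

## References

* A. J. Harper, Compositio Math. 152 (2016), §2.2, §5 [Harper2016].
* H. L. Montgomery, R. C. Vaughan, Acta Arith. 27 (1975), §5–6 [MontgomeryVaughanActa1975].
-/

noncomputable section

open Finset Real Complex
open scoped ArithmeticFunction.Moebius FourierTransform

namespace Literature.NumberTheory.Sieve

namespace SmoothArcs

/-! ### The CRT factorisations -/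

/-- `C_g(h)` as a sum over the whole class with an indicator. [folklore] -/
theorem classGcdSum_eq_sum_ite (m r k : ℕ) (h : ℤ) (g : ℕ) :
    classGcdSum m r k h g = ∑ t ∈ (Finset.range (Nat.lcm k m)).filter (fun t => t ≡ r [MOD m]),
      if Nat.gcd t (Nat.lcm k m) = g then (𝐞 ((h * t : ℝ) / k) : ℂ) else 0 := by
  rw [classGcdSum]
  symm
  rw [← Finset.sum_filter, Finset.filter_filter]

/-- **CRT factorisation of `C_g(h)`.** For `k_i, m_i ≥ 1` with `(k₁m₁, k₂m₂) = 1`, `u₁k₂ ≡ 1 (k₁)`,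
`u₂k₁ ≡ 1 (k₂)` and `g_i ∣ L_i = lcm(k_i, m_i)`:
`C_{g₁g₂}(h; m₁m₂, r, k₁k₂) = C_{g₁}(hu₁; m₁, r, k₁) · C_{g₂}(hu₂; m₂, r, k₂)`. [folklore] -/
theorem classGcdSum_mul_of_coprime {k₁ k₂ m₁ m₂ : ℕ} (hk₁ : k₁ ≠ 0) (hk₂ : k₂ ≠ 0) (hm₁ : m₁ ≠ 0)
    (hm₂ : m₂ ≠ 0) (hc : (k₁ * m₁).Coprime (k₂ * m₂)) (r : ℕ) {h u₁ u₂ : ℤ}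
    (hu₁ : u₁ * k₂ ≡ 1 [ZMOD k₁]) (hu₂ : u₂ * k₁ ≡ 1 [ZMOD k₂]) {g₁ g₂ : ℕ} (hg₁ : g₁ ∣ Nat.lcm k₁ m₁)
    (hg₂ : g₂ ∣ Nat.lcm k₂ m₂) :
    classGcdSum (m₁ * m₂) r (k₁ * k₂) h (g₁ * g₂) =
      classGcdSum m₁ r k₁ (h * u₁) g₁ * classGcdSum m₂ r k₂ (h * u₂) g₂ := by
  have hL : (Nat.lcm k₁ m₁).Coprime (Nat.lcm k₂ m₂) := coprime_lcm_lcm hc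
  have hL₁ : Nat.lcm k₁ m₁ ≠ 0 := Nat.lcm_ne_zero hk₁ hm₁
  have hL₂ : Nat.lcm k₂ m₂ ≠ 0 := Nat.lcm_ne_zero hk₂ hm₂
  have hk : k₁.Coprime k₂ := (hc.coprime_dvd_left (dvd_mul_right _ _)).coprime_dvd_right (dvd_mul_right _ _)
  rw [classGcdSum_eq_sum_ite, classGcdSum_eq_sum_ite, classGcdSum_eq_sum_ite, lcm_mul_mul_eq_lcm_mul_lcm hc,
    Finset.sum_mul_sum,
    ← sum_filter_modEq_crt hL hL₁ hL₂ (Nat.dvd_lcm_right k₁ m₁) (Nat.dvd_lcm_right k₂ m₂)]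
  refine Finset.sum_congr rfl fun t _ => ?_
  rw [gcd_mul_of_coprime' hL t, fourierChar_div_mul_eq_mul hk hk₁ hk₂ hu₁ hu₂ h t,
    fourierChar_mul_div_of_mod_eq (n := t) (t := t % Nat.lcm k₁ m₁) hk₁ (Nat.dvd_lcm_left k₁ m₁) rfl (h * u₁),
    fourierChar_mul_div_of_mod_eq (n := t) (t := t % Nat.lcm k₂ m₂) hk₂ (Nat.dvd_lcm_left k₂ m₂) rfl (h * u₂)]
  by_cases h₁ : Nat.gcd (t % Nat.lcm k₁ m₁) (Nat.lcm k₁ m₁) = g₁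
  · by_cases h₂ : Nat.gcd (t % Nat.lcm k₂ m₂) (Nat.lcm k₂ m₂) = g₂
    · rw [if_pos (by rw [h₁, h₂]), if_pos h₁, if_pos h₂]
    · rw [if_neg ?_, if_pos h₁, if_neg h₂, mul_zero]
      intro heq
      apply h₂
      rw [h₁] at heq
      exact Nat.eq_of_mul_eq_mul_left (Nat.pos_of_dvd_of_pos hg₁ (Nat.pos_of_ne_zero hL₁)) heq
  · rw [if_neg ?_, if_neg h₁, zero_mul]
    intro heq
    apply h₁
    have c₂ : (Nat.gcd (t % Nat.lcm k₂ m₂) (Nat.lcm k₂ m₂)).Coprime (Nat.lcm k₁ m₁) :=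
      Nat.Coprime.coprime_dvd_left (Nat.gcd_dvd_right _ _) hL.symm
    have c₂' : g₂.Coprime (Nat.lcm k₁ m₁) := Nat.Coprime.coprime_dvd_left hg₂ hL.symm
    have e1 := congrArg (fun n => Nat.gcd n (Nat.lcm k₁ m₁)) heq
    rwa [c₂.gcd_mul_right_cancel, c₂'.gcd_mul_right_cancel, Nat.gcd_eq_left (Nat.gcd_dvd_right _ _),
      Nat.gcd_eq_left hg₁] at e1

/-- The same with the gcd split off a divisor `g ∣ L = L₁L₂`: `C_g = C_{(g, L₁)}(hu₁) · C_{(g, L₂)}(hu₂)`.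
[folklore] -/
theorem classGcdSum_mul_of_coprime' {k₁ k₂ m₁ m₂ : ℕ} (hk₁ : k₁ ≠ 0) (hk₂ : k₂ ≠ 0) (hm₁ : m₁ ≠ 0)
    (hm₂ : m₂ ≠ 0) (hc : (k₁ * m₁).Coprime (k₂ * m₂)) (r : ℕ) {h u₁ u₂ : ℤ}
    (hu₁ : u₁ * k₂ ≡ 1 [ZMOD k₁]) (hu₂ : u₂ * k₁ ≡ 1 [ZMOD k₂]) {g : ℕ}
    (hg : g ∣ Nat.lcm (k₁ * k₂) (m₁ * m₂)) :
    classGcdSum (m₁ * m₂) r (k₁ * k₂) h g =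
      classGcdSum m₁ r k₁ (h * u₁) (Nat.gcd g (Nat.lcm k₁ m₁)) *
        classGcdSum m₂ r k₂ (h * u₂) (Nat.gcd g (Nat.lcm k₂ m₂)) := by
  have e : g = Nat.gcd g (Nat.lcm k₁ m₁) * Nat.gcd g (Nat.lcm k₂ m₂) := by
    rw [← Nat.Coprime.gcd_mul g (coprime_lcm_lcm hc), ← lcm_mul_mul_eq_lcm_mul_lcm hc, Nat.gcd_eq_left hg]
  conv_lhs => rw [e]
  exact classGcdSum_mul_of_coprime hk₁ hk₂ hm₁ hm₂ hc r hu₁ hu₂ (Nat.gcd_dvd_right _ _) (Nat.gcd_dvd_right _ _)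

/-- **CRT factorisation of the class local factor.** For `k_i, m_i ≥ 1` with `(k₁m₁, k₂m₂) = 1`
and `u₁k₂ ≡ 1 (mod k₁)`, `u₂k₁ ≡ 1 (mod k₂)`:
`classLocalFactor α (m₁m₂) r (k₁k₂) h = classLocalFactor α m₁ r k₁ (hu₁) · classLocalFactor α m₂ r k₂ (hu₂)`.
[folklore] -/
theorem classLocalFactor_mul_of_coprime (α : ℝ) {k₁ k₂ m₁ m₂ : ℕ} (hk₁ : k₁ ≠ 0) (hk₂ : k₂ ≠ 0)
    (hm₁ : m₁ ≠ 0) (hm₂ : m₂ ≠ 0) (hc : (k₁ * m₁).Coprime (k₂ * m₂)) (r : ℕ) {h u₁ u₂ : ℤ}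
    (hu₁ : u₁ * k₂ ≡ 1 [ZMOD k₁]) (hu₂ : u₂ * k₁ ≡ 1 [ZMOD k₂]) :
    classLocalFactor α (m₁ * m₂) r (k₁ * k₂) h =
      classLocalFactor α m₁ r k₁ (h * u₁) * classLocalFactor α m₂ r k₂ (h * u₂) := by
  have hL : (Nat.lcm k₁ m₁).Coprime (Nat.lcm k₂ m₂) := coprime_lcm_lcm hc
  have hL₁ : Nat.lcm k₁ m₁ ≠ 0 := Nat.lcm_ne_zero hk₁ hm₁
  have hL₂ : Nat.lcm k₂ m₂ ≠ 0 := Nat.lcm_ne_zero hk₂ hm₂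
  have hk : k₁.Coprime k₂ := (hc.coprime_dvd_left (dvd_mul_right _ _)).coprime_dvd_right (dvd_mul_right _ _)
  unfold classLocalFactor
  rw [lcm_mul_mul_eq_lcm_mul_lcm hc, Finset.sum_mul_sum,
    ← sum_filter_modEq_crt hL hL₁ hL₂ (Nat.dvd_lcm_right k₁ m₁) (Nat.dvd_lcm_right k₂ m₂)]
  refine Finset.sum_congr rfl fun t _ => ?_
  rw [gcd_mul_of_coprime' hL t, classWeight_mul hL (Nat.gcd_dvd_right _ _) (Nat.gcd_dvd_right _ _) α,
    fourierChar_div_mul_eq_mul hk hk₁ hk₂ hu₁ hu₂ h t,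
    fourierChar_mul_div_of_mod_eq (n := t) (t := t % Nat.lcm k₁ m₁) hk₁ (Nat.dvd_lcm_left k₁ m₁) rfl (h * u₁),
    fourierChar_mul_div_of_mod_eq (n := t) (t := t % Nat.lcm k₂ m₂) hk₂ (Nat.dvd_lcm_left k₂ m₂) rfl (h * u₂)]
  push_cast
  ring

/-- **CRT factorisation of the cancelling majorant** (same hypotheses):
`classLocalHc α (m₁m₂) r (k₁k₂) h = classLocalHc α m₁ r k₁ (hu₁) · classLocalHc α m₂ r k₂ (hu₂)`. [folklore] -/
theorem classLocalHc_mul_of_coprime (α : ℝ) {k₁ k₂ m₁ m₂ : ℕ} (hk₁ : k₁ ≠ 0) (hk₂ : k₂ ≠ 0)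
    (hm₁ : m₁ ≠ 0) (hm₂ : m₂ ≠ 0) (hc : (k₁ * m₁).Coprime (k₂ * m₂)) (r : ℕ) {h u₁ u₂ : ℤ}
    (hu₁ : u₁ * k₂ ≡ 1 [ZMOD k₁]) (hu₂ : u₂ * k₁ ≡ 1 [ZMOD k₂]) :
    classLocalHc α (m₁ * m₂) r (k₁ * k₂) h =
      classLocalHc α m₁ r k₁ (h * u₁) * classLocalHc α m₂ r k₂ (h * u₂) := by
  have hL : (Nat.lcm k₁ m₁).Coprime (Nat.lcm k₂ m₂) := coprime_lcm_lcm hc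
  unfold classLocalHc
  rw [lcm_mul_mul_eq_lcm_mul_lcm hc, Finset.sum_mul_sum, ← Finset.sum_product', Nat.divisors_mul,
    ← Finset.image_mul_product, Finset.sum_image (Nat.Coprime.mul_injOn_divisors hL)]
  refine Finset.sum_congr rfl fun p hp => ?_
  obtain ⟨h₁, h₂⟩ := Finset.mem_product.mp hp
  have hg₁ := Nat.dvd_of_mem_divisors h₁
  have hg₂ := Nat.dvd_of_mem_divisors h₂
  rw [classGcdSum_mul_of_coprime hk₁ hk₂ hm₁ hm₂ hc r hu₁ hu₂ hg₁ hg₂, norm_mul, classWeightTau_mul hL hg₁ hg₂ α]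
  ring

/-! ### Coprime modulus: `(k, m) = 1` -/

/-- The case `m = 1`: `C_g(h; 1, r, k) = c_{k/g}(h)` for `g ∣ k` (and `0` otherwise), `k ≥ 1`. [folklore] -/
theorem classGcdSum_one {k : ℕ} (hk : k ≠ 0) (r : ℕ) (h : ℤ) (g : ℕ) :
    classGcdSum 1 r k h g = if g ∣ k then ramanujanSum (k / g) h else 0 := by
  rw [← sum_filter_gcd_fourierChar hk h g, classGcdSum, Nat.lcm_one_right]
  refine Finset.sum_congr (Finset.filter_congr fun t _ => ?_) fun _ _ => rfl
  exact ⟨fun ht => ht.2, fun ht => ⟨Nat.modEq_one, ht⟩⟩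

/-- **Coprime modulus.** For coprime `k, m ≥ 1` and `(r, m) = 1`: the class condition `t ≡ r (m)` only
fixes the unit coordinate mod `m`, so `C_g(h; m, r, k) = c_{k/g}(h)` (Ramanujan sum) if `g ∣ k`, else `0`.
[cite: MontgomeryVaughanActa1975, §5] -/
theorem classGcdSum_of_coprime {k m : ℕ} (hk : k ≠ 0) (hm : m ≠ 0) (hkm : k.Coprime m) {r : ℕ}
    (hr : r.Coprime m) (h : ℤ) (g : ℕ) :
    classGcdSum m r k h g = if g ∣ k then ramanujanSum (k / g) h else 0 := by
  rw [← sum_filter_gcd_fourierChar hk h g, Finset.sum_filter, classGcdSum_eq_sum_ite, hkm.lcm_eq_mul,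
    ← sum_filter_modEq_mod_of_coprime hkm hk hm r
      (fun s => if Nat.gcd s k = g then (𝐞 ((h * s : ℝ) / k) : ℂ) else 0)]
  refine Finset.sum_congr rfl fun t ht => ?_
  obtain ⟨-, htr⟩ := Finset.mem_filter.mp ht
  have htm : m.Coprime t := by
    rw [Nat.Coprime, Nat.gcd_comm, htr.gcd_eq]; exact hr
  rw [htm.gcd_mul_right_cancel_right, Nat.gcd_comm t k, Nat.gcd_rec k t,
    fourierChar_mul_div_of_mod_eq (n := t) (t := t % k) hk dvd_rfl rfl h]

/-- **The class local factor for a coprime modulus.** For coprime `k, m ≥ 1`, `(r, m) = 1`: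
`classLocalFactor α m r k h = [∏_{p ∣ m}(1 − p^{−α})/φ(m)] · ∑_{g ∣ k} c_{k/g}(h) g^{−α} ∏_{p ∣ k/g}(1 − p^{−α})/φ(k/g)`
— independent of the class `r`. [cite: Harper2016, §2.2] -/
theorem classLocalFactor_of_coprime (α : ℝ) {k m : ℕ} (hk : k ≠ 0) (hm : m ≠ 0) (hkm : k.Coprime m)
    {r : ℕ} (hr : r.Coprime m) (h : ℤ) :
    classLocalFactor α m r k h =
      ((((∏ p ∈ m.primeFactors, (1 - (p : ℝ) ^ (-α))) / (m.totient : ℝ) : ℝ)) : ℂ) *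
        ∑ g ∈ k.divisors, ramanujanSum (k / g) h *
          ((((g : ℕ) : ℝ) ^ (-α) * (∏ p ∈ (k / g).primeFactors, (1 - (p : ℝ) ^ (-α))) /
            ((k / g).totient : ℝ) : ℝ) : ℂ) := by
  rw [classLocalFactor_eq_sum_divisors, hkm.lcm_eq_mul, Finset.mul_sum,
    ← Nat.divisors_filter_dvd_of_dvd (mul_ne_zero hk hm) (dvd_mul_right k m), Finset.sum_filter]
  refine Finset.sum_congr rfl fun g _ => ?_
  rw [classGcdSum_of_coprime hk hm hkm hr h g]
  split_ifs with hg
  · have e1 : k * m / g = k / g * m := (Nat.div_mul_right_comm hg m).symm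
    have hcop : (k / g).Coprime m := hkm.coprime_dvd_left (Nat.div_dvd_of_dvd hg)
    rw [e1, Nat.totient_mul hcop, hcop.primeFactors_mul, Finset.prod_union hcop.disjoint_primeFactors]
    push_cast
    ring
  · rw [zero_mul]

/-- … and for `(h, k) = 1` moreover `c_{k/g}(h) = μ(k/g)`, so
`classLocalFactor α m r k h = [∏_{p ∣ m}(1 − p^{−α})/φ(m)] · G_α(k)` (`localG`). [cite: Harper2016, §2.2] -/
theorem classLocalFactor_of_coprime_of_coprime (α : ℝ) {k m : ℕ} (hk : k ≠ 0) (hm : m ≠ 0)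
    (hkm : k.Coprime m) {r : ℕ} (hr : r.Coprime m) {h : ℤ} (hh : k.Coprime h.natAbs) :
    classLocalFactor α m r k h =
      ((((∏ p ∈ m.primeFactors, (1 - (p : ℝ) ^ (-α))) / (m.totient : ℝ) : ℝ)) : ℂ) * (localG α k : ℂ) := by
  rw [classLocalFactor_of_coprime α hk hm hkm hr h, localG, Complex.ofReal_sum]
  congr 1
  refine Finset.sum_congr rfl fun g hg => ?_
  have hgk : g ∣ k := Nat.dvd_of_mem_divisors hg
  have hk'0 : k / g ≠ 0 := (Nat.div_ne_zero_iff_of_dvd hgk).mpr ⟨hk, (Nat.pos_of_mem_divisors hg).ne'⟩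
  have hR : ∑ d ∈ (k / g).divisors, (μ (k / g) : ℝ) * (μ d : ℝ) * ((g * d : ℕ) : ℝ) ^ (-α) / ((k / g).totient : ℝ) =
      (μ (k / g) : ℝ) * (((g : ℕ) : ℝ) ^ (-α) * (∏ p ∈ (k / g).primeFactors, (1 - (p : ℝ) ^ (-α))) /
        ((k / g).totient : ℝ)) := by
    rw [← sum_divisors_moebius_rpow hk'0 α, Finset.mul_sum, Finset.sum_div, Finset.mul_sum]
    refine Finset.sum_congr rfl fun d _ => ?_
    have hgd : ((g * d : ℕ) : ℝ) ^ (-α) = (g : ℝ) ^ (-α) * (d : ℝ) ^ (-α) := by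
      push_cast; exact Real.mul_rpow (Nat.cast_nonneg g) (Nat.cast_nonneg d)
    rw [hgd]; ring
  rw [hR, ramanujanSum_eq_moebius_of_coprime_natAbs (hh.coprime_dvd_left (Nat.div_dvd_of_dvd hgk))]
  push_cast
  ring

/-! ### Bounds -/

/-- Trivial bound: `‖C_g(h)‖ ≤ #{t < L : t ≡ r (m), (t, L) = g}`. [folklore] -/
theorem norm_classGcdSum_le_card (m r k : ℕ) (h : ℤ) (g : ℕ) :
    ‖classGcdSum m r k h g‖ ≤ (((Finset.range (Nat.lcm k m)).filter
      (fun t => t ≡ r [MOD m] ∧ Nat.gcd t (Nat.lcm k m) = g)).card : ℝ) := by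
  unfold classGcdSum
  refine (norm_sum_le _ _).trans (le_of_eq ?_)
  simp only [Circle.norm_coe, Finset.sum_const, nsmul_eq_mul, mul_one]

/-- **The cancelling majorant for a coprime modulus.** For coprime `k, m ≥ 1`, `(r, m) = 1`:
`classLocalHc α m r k h = τ(m)/φ(m) · ∑_{g ∣ k} |c_{k/g}(h)| g^{−α} τ(k/g)/φ(k/g)`. [cite: Harper2016, §2.2] -/
theorem classLocalHc_of_coprime (α : ℝ) {k m : ℕ} (hk : k ≠ 0) (hm : m ≠ 0) (hkm : k.Coprime m) {r : ℕ}
    (hr : r.Coprime m) (h : ℤ) :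
    classLocalHc α m r k h = ((m.divisors.card : ℝ) / (m.totient : ℝ)) *
      ∑ g ∈ k.divisors, ‖ramanujanSum (k / g) h‖ *
        (((g : ℕ) : ℝ) ^ (-α) * ((k / g).divisors.card : ℝ) / ((k / g).totient : ℝ)) := by
  unfold classLocalHc
  rw [hkm.lcm_eq_mul, Finset.mul_sum, ← Nat.divisors_filter_dvd_of_dvd (mul_ne_zero hk hm) (dvd_mul_right k m),
    Finset.sum_filter]
  refine Finset.sum_congr rfl fun g _ => ?_
  rw [classGcdSum_of_coprime hk hm hkm hr h g]
  split_ifs with hg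
  · have e1 : k * m / g = k / g * m := (Nat.div_mul_right_comm hg m).symm
    have hcop : (k / g).Coprime m := hkm.coprime_dvd_left (Nat.div_dvd_of_dvd hg)
    rw [e1, Nat.totient_mul hcop, Nat.Coprime.card_divisors_mul hcop]
    push_cast
    ring
  · rw [norm_zero, zero_mul]

/-- **… and for `(h, k) = 1`:** `classLocalHc α m r k h ≤ τ(m) τ(k)/φ(m) · H_α(k)` (`localH`; using
`|c_{k/g}(h)| = |μ(k/g)|`, `τ(k/g) ≤ τ(k)` and the `d = 1` term of `H_α`). [cite: Harper2016, §2.2] -/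
theorem classLocalHc_le_of_coprime (α : ℝ) {k m : ℕ} (hk : k ≠ 0) (hm : m ≠ 0) (hkm : k.Coprime m)
    {r : ℕ} (hr : r.Coprime m) {h : ℤ} (hh : k.Coprime h.natAbs) :
    classLocalHc α m r k h ≤
      ((m.divisors.card : ℝ) * (k.divisors.card : ℝ) / (m.totient : ℝ)) * localH α k := by
  rw [classLocalHc_of_coprime α hk hm hkm hr h, localH,
    show (m.divisors.card : ℝ) * (k.divisors.card : ℝ) / (m.totient : ℝ) =
      (m.divisors.card : ℝ) / (m.totient : ℝ) * (k.divisors.card : ℝ) by ring, mul_assoc]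
  refine mul_le_mul_of_nonneg_left ?_ (by positivity)
  rw [Finset.mul_sum]
  refine Finset.sum_le_sum fun g hg => ?_
  have hgk : g ∣ k := Nat.dvd_of_mem_divisors hg
  have hk' : k / g ≠ 0 := (Nat.div_ne_zero_iff_of_dvd hgk).mpr ⟨hk, (Nat.pos_of_mem_divisors hg).ne'⟩
  rw [ramanujanSum_eq_moebius_of_coprime_natAbs (hh.coprime_dvd_left (Nat.div_dvd_of_dvd hgk)), Complex.norm_intCast]
  have hA : 0 ≤ |((μ (k / g) : ℤ) : ℝ)| * ((g : ℕ) : ℝ) ^ (-α) / ((k / g).totient : ℝ) := by positivity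
  have h2 : ((k / g).divisors.card : ℝ) ≤ (k.divisors.card : ℝ) := by
    exact_mod_cast Finset.card_le_card (Nat.divisors_subset_of_dvd hk (Nat.div_dvd_of_dvd hgk))
  have h1 : |((μ (k / g) : ℤ) : ℝ)| * ((g : ℕ) : ℝ) ^ (-α) / ((k / g).totient : ℝ) ≤
      ∑ d ∈ (k / g).divisors, |(μ (k / g) : ℝ)| * |(μ d : ℝ)| * ((g * d : ℕ) : ℝ) ^ (-α) /
        ((k / g).totient : ℝ) := by
    have := Finset.single_le_sum (s := (k / g).divisors)
      (f := fun d => |(μ (k / g) : ℝ)| * |(μ d : ℝ)| * ((g * d : ℕ) : ℝ) ^ (-α) / ((k / g).totient : ℝ))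
      (fun d _ => by positivity) (Nat.one_mem_divisors.mpr hk')
    refine le_trans (le_of_eq ?_) this
    rw [ArithmeticFunction.moebius_apply_one, mul_one, Int.cast_one, abs_one, mul_one]
  calc |((μ (k / g) : ℤ) : ℝ)| * (((g : ℕ) : ℝ) ^ (-α) * ((k / g).divisors.card : ℝ) / ((k / g).totient : ℝ))
      = ((k / g).divisors.card : ℝ) * (|((μ (k / g) : ℤ) : ℝ)| * ((g : ℕ) : ℝ) ^ (-α) / ((k / g).totient : ℝ)) := by
        ring
    _ ≤ (k.divisors.card : ℝ) * (|((μ (k / g) : ℤ) : ℝ)| * ((g : ℕ) : ℝ) ^ (-α) / ((k / g).totient : ℝ)) :=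
        mul_le_mul_of_nonneg_right h2 hA
    _ ≤ (k.divisors.card : ℝ) * ∑ d ∈ (k / g).divisors, |(μ (k / g) : ℝ)| * |(μ d : ℝ)| *
          ((g * d : ℕ) : ℝ) ^ (-α) / ((k / g).totient : ℝ) :=
        mul_le_mul_of_nonneg_left h1 (Nat.cast_nonneg _)

end SmoothArcs

end Literature.NumberTheory.Sieve

end
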